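import Literature.Geometry.Lorentzian.StabilityCauchy
import Literature.Geometry.Lorentzian.KerrConvergence
import HarnessLib

/-!
# Sketch — crux-ideate `BulkKerrCaptureC2` (stmt-FinalStateConjecture-14985), ideator 1, round 1

First-lemma signatures for the two idea cards of this seat (statements only; D-0014: the planner
proves nothing here — everything below is a `def … : Prop`, no `sorry`).

* Card `germ-cover-port`: `ConormalGerm`, `FiniteOrderGerm`, `GermCoverPort` (first lemma),
  `ClaimGivesConormalGerms` (instance 1: the landed all-orders claim serves every centre).
* Card `order-lift-landau-kolmogorov`: `SegmentLandau` (analysis stub), `OrderLift` (first lemma,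
  tree level), `BddConvergesToKerr` / `BulkKerrCaptureBdd` (the transfer `C⁺`) and
  `OrderLiftTransfer` (how the line concludes the crux by name).
-/

noncomputable section

open Set Filter Topology Function
open scoped Manifold ContDiff ENNReal Topology
open Literature.Geometry.Lorentzian

namespace Summit.FinalStateConjecture.FinalStateConjecture.Cruxes.BulkKerrCaptureC2.Ideator1

/-! ## Verbatim local copies (farm snapshot lag)

The farm node serving `lean check` for session files did not yet know today's tree additions
(`CruxC2`, rev 15, 07:04Z; `hintz_kerr_stability_subextremal_
cauchy_allOrders`, wi-30700) at 07:40Z — "Unknown identifier". So the two are copied here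
BYTE-FOR-BYTE (crux: the ledger signature of stmt-FinalStateConjecture-14985; claim: the body in
`Literature/Geometry/Lorentzian/KerrStabilitySubextremalCauchy.lean`); in the tree the first
lemmas read with the tree names substituted (`CruxC2 := BulkKerrCaptureC2`,
`ClaimAllOrders := hintz_kerr_stability_subextremal_cauchy_allOrders`, both `Iff.rfl`). -/

/-- VERBATIM the ledger signature of the crux `BulkKerrCaptureC2` (stmt-FinalStateConjecture-14985). -/
def CruxC2 : Prop :=
  ∀ [Literature.Geometry.Lorentzian.Kerr.Facts] [Literature.Geometry.Lorentzian.Kerr.SliceFacts], ∀ a₁ : ℝ, a₁ < 1 → ∃ (s : ℕ) (δ : ℝ), ∀ (M : ℝ) (hM : 0 < M), ∀ η > (0 : ℝ), ∃ ε > (0 : ℝ), ∀ a : ℝ, |a| ≤ a₁ * M → ∀ (D : Literature.Geometry.Lorentzian.InitialDataSet 𝓘(ℝ, Literature.Geometry.Lorentzian.E3) (Literature.Geometry.Lorentzian.Kerr.slice a M)) [D.metric.HasLeviCivita], D.IsVacuumConstraintSolution → (∀ s' : ℕ, Literature.Geometry.Lorentzian.InitialDataSet.dataWeightedSobolevEDist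 s' δ D (Literature.Geometry.Lorentzian.Kerr.data M a M hM.le) < ⊤) → Literature.Geometry.Lorentzian.InitialDataSet.dataWeightedSobolevEDist s δ D (Literature.Geometry.Lorentzian.Kerr.data M a M hM.le) < ENNReal.ofReal ε → ∀ 𝒟 : Literature.Geometry.Lorentzian.VacuumCauchyDevelopment D, 𝒟.IsMaximal → ∃ (M' a' : ℝ) (𝒟oc : Set 𝒟.carrier), Literature.Geometry.Lorentzian.Kerr.IsSubextremal M' a' ∧ (∀ [𝒟.metric.HasLeviCivita], ∃ B₀ : Set (Literature.Geometry.Lorentzian.Kerr.slice a M), IsCompact B₀ ∧ ∀ σ : ℝ, 0 < σ → ∃ B₁ : Set (Literature.Geometry.Lorentzian.Kerr.slice a M), IsCompact B₁ ∧ ∀ q ∈ {q : Literature.Geometry.Lorentzian.Kerr.slice a M | Literature.Geometry.Lorentzian.Kerr.afRadius a M + 1 ≤ ‖(q : Literature.Geometry.Lorentzian.E3)‖}, q ∉ B₁ → ∀ (ray : ℝ → 𝒟.carrier) (dom : Set ℝ), 𝒟.metric.IsNormalisedNullRayFrom 𝒟.timeOrientation 𝒟.embed 𝒟.normal q ray dom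 → ¬ BddAbove dom ∨ ENNReal.ofReal σ ≤ Literature.Geometry.Lorentzian.sojournTime ray dom (𝒟.metric.causalFuture 𝒟.timeOrientation (𝒟.embed '' B₀))) ∧ 𝒟.toSpacetime.ConvergesToKerr 𝒟oc M' a' 2 ∧ |M' - M| + |a' - a| ≤ η

/-- VERBATIM the body of `Literature.Geometry.Lorentzian.hintz_kerr_stability_subextremal_cauchy_allOrders`. -/
def ClaimAllOrders [Kerr.Facts] [Kerr.SliceFacts] : Prop :=
  ∀ χ₀ : ℝ, |χ₀| < 1 → ∀ ρ₀ ∈ Set.Ioo (1 - √(1 - χ₀ ^ 2)) (1 + √(1 - χ₀ ^ 2)),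
    ∃ (s : ℕ) (δ : ℝ), ∃ ς > (0 : ℝ), ∀ (M : ℝ) (hM : 0 < M), ∀ η > (0 : ℝ), ∃ ε > (0 : ℝ),
      ∀ a r₀ : ℝ, |a / M - χ₀| < ς → r₀ = ρ₀ * M →
        r₀ ∈ Set.Ioo (Kerr.rMinus M a) (Kerr.rPlus M a) →
        ∀ (D : InitialDataSet 𝓘(ℝ, E3) (Kerr.slice a r₀)) [D.metric.HasLeviCivita],
          D.IsVacuumConstraintSolution →
          (∀ s' : ℕ,
            InitialDataSet.dataWeightedSobolevEDist s' δ D (Kerr.data M a r₀ hM.le) < ⊤) →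
          InitialDataSet.dataWeightedSobolevEDist s δ D (Kerr.data M a r₀ hM.le) <
            ENNReal.ofReal ε →
          ∀ 𝒟 : VacuumCauchyDevelopment D, 𝒟.IsMaximal →
            ∃ (M' a' : ℝ) (𝒟oc : Set 𝒟.carrier), Kerr.IsSubextremal M' a' ∧
              |M' - M| + |a' - a| ≤ η ∧
              𝒟.HasCompleteFutureNullInfinityFar ∧
              ∀ k : ℕ, 𝒟.toSpacetime.ConvergesToKerr 𝒟oc M' a' k

/-! ## Card A — germ-cover port -/

/-- Capture GERM at the normalised centre `χ₀ ∈ (−1, 1)`, CONORMAL door (the shape of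
`hintz_kerr_stability_subextremal_cauchy_allOrders` at inner radius `ρ₀ = 1`, i.e. `r₀ = M`):
one `(s, δ, ς)` and, per `(M, η)`, one `ε` serving every spin in the ball `|a/M − χ₀| < ς`;
b-conormal data; convergence in every `Cᵏ`. -/
def ConormalGerm [Kerr.Facts] [Kerr.SliceFacts] (χ₀ : ℝ) : Prop :=
  ∃ (s : ℕ) (δ : ℝ), ∃ ς > (0 : ℝ), ∀ (M : ℝ) (hM : 0 < M), ∀ η > (0 : ℝ), ∃ ε > (0 : ℝ),
    ∀ a : ℝ, |a / M - χ₀| < ς → Kerr.IsSubextremal M a →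
      ∀ (D : InitialDataSet 𝓘(ℝ, E3) (Kerr.slice a M)) [D.metric.HasLeviCivita],
        D.IsVacuumConstraintSolution →
        (∀ s' : ℕ,
          InitialDataSet.dataWeightedSobolevEDist s' δ D (Kerr.data M a M hM.le) < ⊤) →
        InitialDataSet.dataWeightedSobolevEDist s δ D (Kerr.data M a M hM.le) <
          ENNReal.ofReal ε →
        ∀ 𝒟 : VacuumCauchyDevelopment D, 𝒟.IsMaximal →
          ∃ (M' a' : ℝ) (𝒟oc : Set 𝒟.carrier), Kerr.IsSubextremal M' a' ∧
            |M' - M| + |a' - a| ≤ η ∧ 𝒟.HasCompleteFutureNullInfinityFar ∧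
            ∀ k : ℕ, 𝒟.toSpacetime.ConvergesToKerr 𝒟oc M' a' k

/-- Capture GERM at `χ₀`, FINITE-ORDER door (the Klainerman–Szeftel / GKS output shape, read with
constants uniform on a spin ball and the convergence order exposed): a bare `H^s_δ`-ball (no
conormality side condition) and ONE order `k ≥ 2`. -/
def FiniteOrderGerm [Kerr.Facts] [Kerr.SliceFacts] (χ₀ : ℝ) : Prop :=
  ∃ (s : ℕ) (δ : ℝ) (k : ℕ), 2 ≤ k ∧ ∃ ς > (0 : ℝ), ∀ (M : ℝ) (hM : 0 < M), ∀ η > (0 : ℝ),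
    ∃ ε > (0 : ℝ), ∀ a : ℝ, |a / M - χ₀| < ς → Kerr.IsSubextremal M a →
      ∀ (D : InitialDataSet 𝓘(ℝ, E3) (Kerr.slice a M)) [D.metric.HasLeviCivita],
        D.IsVacuumConstraintSolution →
        InitialDataSet.dataWeightedSobolevEDist s δ D (Kerr.data M a M hM.le) <
          ENNReal.ofReal ε →
        ∀ 𝒟 : VacuumCauchyDevelopment D, 𝒟.IsMaximal →
          ∃ (M' a' : ℝ) (𝒟oc : Set 𝒟.carrier), Kerr.IsSubextremal M' a' ∧
            |M' - M| + |a' - a| ≤ η ∧ 𝒟.HasCompleteFutureNullInfinityFar ∧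
            𝒟.toSpacetime.ConvergesToKerr 𝒟oc M' a' k

/-- **First lemma of card `germ-cover-port`.** A cover of the open interval of admissible centres
by germs of EITHER shape implies the crux: Lebesgue number of a finite subcover of
`[−a₁, a₁] ⊂ (−1, 1)`, `max s`, `max δ`, `min ε` over the subcover, `(s, δ)`-monotonicity of the
data distance, the conormal hypothesis of the crux simply dropped at finite-order centres,
`ConvergesTo.of_le` (`k ≥ 2 ↦ 2`) resp. instantiation (`∀ k ↦ 2`), and the definitional identity of
the crux's inlined sojourn clause with `HasCompleteFutureNullInfinityFar`. -/
def GermCoverPort : Prop :=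
  (∀ [Kerr.Facts] [Kerr.SliceFacts], ∀ χ₀ : ℝ, |χ₀| < 1 → ConormalGerm χ₀ ∨ FiniteOrderGerm χ₀) →
    CruxC2

/-- Instance 1 of the cover (closes the crux NOW, modulo the claim): the landed all-orders
re-vendoring of Hintz 2026 Thm 13.1 + Rem 13.2 serves the conormal germ at EVERY centre
(`hintz_kerr_stability_subextremal_cauchy_allOrders` at `ρ₀ = 1`, which is admissible since
`1 ∈ (1 − √(1 − χ₀²), 1 + √(1 − χ₀²))`). -/
def ClaimGivesConormalGerms : Prop :=
  ∀ [Kerr.Facts] [Kerr.SliceFacts],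
    ClaimAllOrders → ∀ χ₀ : ℝ, |χ₀| < 1 → ConormalGerm χ₀

/-! ## Card B — order lift by a one-sided Landau–Kolmogorov inequality -/

/-- Analysis stub (Mathlib-only): ONE-SIDED SEGMENT LANDAU INEQUALITY. If `f` is `C²` on an open
set `U` which contains, for every unit direction `v`, one of the two segments `[x, x ± ρ v]`, then
`‖Df(x)‖ ≤ 2‖f‖_{∞,U}/ρ + ‖D²f‖_{∞,U} ρ` (Taylor along the admissible segment; Adams–Fournier §4.10,
the pointwise step, `p = ∞`). -/
def SegmentLandau : Prop :=
  ∀ {V F : Type} [NormedAddCommGroup V] [NormedSpace ℝ V] [NormedAddCommGroup F]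
    [NormedSpace ℝ F] (U : Set V) (f : V → F) (x : V) (ρ M₀ M₂ : ℝ), IsOpen U → 0 < ρ →
    ContDiffOn ℝ 2 f U →
    (∀ v : V, ‖v‖ = 1 → segment ℝ x (x + ρ • v) ⊆ U ∨ segment ℝ x (x - ρ • v) ⊆ U) →
    (∀ y ∈ U, ‖f y‖ ≤ M₀) → (∀ y ∈ U, ‖iteratedFDeriv ℝ 2 f y‖ ≤ M₂) →
    ‖fderiv ℝ f x‖ ≤ 2 * M₀ / ρ + M₂ * ρ

/-- **First lemma of card `order-lift-landau-kolmogorov`** (tree level). In ONE late chart `Ψ` of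
the Kerr background: `C⁰`-convergence of the metric deviation on the slabs `{t* = τ}` plus a
UNIFORM `Cᵐ` bound on the late region upgrade to `Cᵏ`-convergence for every `k < m` (the late
region `{t* > τ₀} × {r > r₊}` has the one-sided segment property in `E4`: half-line in time,
complement of the solid confocal ellipsoid `{r ≤ r₊}` — a convex body — in space). -/
def OrderLift : Prop :=
  ∀ (𝓢 : Spacetime.{0} 4) (M a : ℝ), 0 < M → Kerr.IsSubextremal M a →
    ∀ (𝒟 : Set 𝓢.carrier) (τ₀ : ℝ) (Ψ : (Kerr.background M a).domain → 𝓢.carrier),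
      𝓢.IsLateEmbedding (Kerr.background M a) 𝒟 τ₀ Ψ →
      ContDiffOn ℝ ∞ (𝓢.deviationExtend (Kerr.background M a) Ψ)
        (Subtype.val '' Kerr.lateRegion M a τ₀) →
      Tendsto (fun τ ↦ 𝓢.deviationCk (Kerr.background M a) Ψ 0 τ) atTop (𝓝 0) →
      ∀ m : ℕ, (∃ C : ℝ≥0∞, C ≠ ⊤ ∧
          ∀ τ : ℝ, τ₀ < τ → 𝓢.deviationCk (Kerr.background M a) Ψ m τ ≤ C) →
        ∀ k : ℕ, k < m → 𝓢.ConvergesToKerr 𝒟 M a k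

/-- The transfer's convergence clause: `C⁰`-convergence AND a uniform `Cᵐ` bound in the SAME late
chart (with the deviation smooth on the late region). -/
def BddConvergesToKerr (𝓢 : Spacetime.{0} 4) (𝒟 : Set 𝓢.carrier) (M a : ℝ) (m : ℕ) : Prop :=
  ∃ (τ₀ : ℝ) (Ψ : (Kerr.background M a).domain → 𝓢.carrier),
    𝓢.IsLateEmbedding (Kerr.background M a) 𝒟 τ₀ Ψ ∧
    ContDiffOn ℝ ∞ (𝓢.deviationExtend (Kerr.background M a) Ψ)
      (Subtype.val '' Kerr.lateRegion M a τ₀) ∧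
    Tendsto (fun τ ↦ 𝓢.deviationCk (Kerr.background M a) Ψ 0 τ) atTop (𝓝 0) ∧
    ∃ C : ℝ≥0∞, C ≠ ⊤ ∧ ∀ τ : ℝ, τ₀ < τ → 𝓢.deviationCk (Kerr.background M a) Ψ m τ ≤ C

/-- `C⁺` of card B: the crux with its convergence clause replaced by `BddConvergesToKerr … 3`
("decays at order 0, bounded at order 3, one chart"); everything else VERBATIM the crux. -/
def BulkKerrCaptureBdd : Prop :=
  ∀ [Kerr.Facts] [Kerr.SliceFacts], ∀ a₁ : ℝ, a₁ < 1 → ∃ (s : ℕ) (δ : ℝ), ∀ (M : ℝ) (hM : 0 < M),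
    ∀ η > (0 : ℝ), ∃ ε > (0 : ℝ), ∀ a : ℝ, |a| ≤ a₁ * M →
      ∀ (D : InitialDataSet 𝓘(ℝ, E3) (Kerr.slice a M)) [D.metric.HasLeviCivita],
        D.IsVacuumConstraintSolution →
        (∀ s' : ℕ,
          InitialDataSet.dataWeightedSobolevEDist s' δ D (Kerr.data M a M hM.le) < ⊤) →
        InitialDataSet.dataWeightedSobolevEDist s δ D (Kerr.data M a M hM.le) <
          ENNReal.ofReal ε →
        ∀ 𝒟 : VacuumCauchyDevelopment D, 𝒟.IsMaximal →
          ∃ (M' a' : ℝ) (𝒟oc : Set 𝒟.carrier), Kerr.IsSubextremal M' a' ∧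
            (∀ [𝒟.metric.HasLeviCivita], ∃ B₀ : Set (Kerr.slice a M), IsCompact B₀ ∧
              ∀ σ : ℝ, 0 < σ → ∃ B₁ : Set (Kerr.slice a M), IsCompact B₁ ∧
                ∀ q ∈ {q : Kerr.slice a M | Kerr.afRadius a M + 1 ≤ ‖(q : E3)‖}, q ∉ B₁ →
                  ∀ (ray : ℝ → 𝒟.carrier) (dom : Set ℝ),
                    𝒟.metric.IsNormalisedNullRayFrom 𝒟.timeOrientation 𝒟.embed 𝒟.normal q ray
                      dom →
                    ¬ BddAbove dom ∨ ENNReal.ofReal σ ≤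
                      sojournTime ray dom
                        (𝒟.metric.causalFuture 𝒟.timeOrientation (𝒟.embed '' B₀))) ∧
            BddConvergesToKerr 𝒟.toSpacetime 𝒟oc M' a' 3 ∧ |M' - M| + |a' - a| ≤ η

/-- How card B concludes the crux BY NAME: the order lift turns `C⁺` into `BulkKerrCaptureC2`
(`2 < 3`; `0 < M'` and `|a'| < M'` from `IsSubextremal M' a'`). -/
def OrderLiftTransfer : Prop :=
  OrderLift → BulkKerrCaptureBdd → CruxC2

end Summit.FinalStateConjecture.FinalStateConjecture.Cruxes.BulkKerrCaptureC2.Ideator1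

end
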